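import Literature.RepresentationTheory.HeisenbergGroup.CharacterDualLattice
import Literature.RepresentationTheory.HeisenbergGroup.HeisenbergGroup
import Literature.RepresentationTheory.Unitary.IsometricFixedVector
import HarnessLib

/-!
# Lattice-fixed vectors: every unitary representation of the `p`-adic Heisenberg group with central character `ψ`
# contains a non-zero vector fixed by the self-dual lattice `B₁ × B₁^⊥`

Topic `RepresentationTheory/HeisenbergGroup`; namespace `Literature.RepresentationTheory.HeisenbergGroup`.  KERNEL ONLY:
theorems; no definition, no named fact, no record, no `sorry`.

Setting of `CharacterDualLattice.lean`: `F` a non-archimedean normed field with compact closed balls, `T ∈ GL_n(F)`,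
`ψ : F → S¹` continuous and non-trivial, `B_r = {x ∈ Fⁿ ; ‖x‖ ≤ r}`, `A^⊥ = charDual T ψ A`.  Let `π` be a representation
of the polarised Heisenberg group `H = Heisenberg (polar β_T)` (`β_T(x, y) = x · T y`) on a complex Hilbert space `E` by
linear isometries, with continuous orbit maps `w ↦ π(w, 0) v` and central character `ψ` (`π(0, t) = ψ(t)`).  MAIN RESULT
(**`exists_latticeFixed_ne_zero`**): if `E ≠ 0` there is `v₀ ≠ 0` with `π(x, 0, 0) v₀ = v₀` for all `x ∈ B₁` and
`π(0, y, 0) v₀ = v₀` for all `y ∈ B₁^⊥` — the unitary counterpart of [MoeglinVignerasWaldspurger1987, Chap. 2 I.6–I.8]'s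
"`S'(ψ_A) ≠ 0`" for the self-dual lattice `A = B₁ × B₁^⊥` (`A = A^⊥`, I.3), which there is obtained from the projector
`ρ'(f_A)`; here no Haar measure or integral is used:

* §1 the Weyl form of the relations of `H` under `π`: `x ↦ π(x,0,0)` and `y ↦ π(0,y,0)` are representations of the additive
  group `Fⁿ` (`inlRep_apply`, `inrRep_apply` for representations of `Multiplicative Fⁿ` built inside the proofs) with
  `π(x,0,0) π(0,y,0) = ψ(x · T y) π(0,y,0) π(x,0,0)` (`apply_inl_inr`);
* §2 **the averaging step** (`exists_sum_fixed_ne_zero`), for an abstract pair of representations `α`, `β` of `Fⁿ` on a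
  complex vector space with `α_x β_y = ψ(x · S y) β_y α_x`: from `u ≠ 0` fixed by `α(A₀)` (`A₀ ≤ A` open in `A` compact,
  finite quotient) the averages `w_y = ∑_{q ∈ A/A₀} α_{s(q)} β_y u`, `y ∈ A₀^⊥`, are `α(A)`-fixed, and NOT ALL ZERO: applying
  `β_{-y}` turns `w_y = 0 ∀ y` into `∑_q ψ(s(q) · S y) α_{s(q)} u = 0` for all `y ∈ A₀^⊥`, a vanishing combination with the
  pairwise distinct characters `quotChar (s q)` of the finite group `A₀^⊥/A^⊥` (distinct by the separation `(A₀^⊥)^⊥ = A₀`),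
  whence `α_{s(q)} u = 0` by the finite Fourier inversion `eq_zero_of_forall_sum_smul_eq_zero` — contradiction;
* §3 the unitary case: a vector almost invariant under a small ball `B_δ` (strong continuity) gives a `B_δ`-fixed vector
  (`Unitary.exists_fixed_ne_zero_of_forall_norm_sub_lt`, the integral-free averaging of `IsometricFixedVector.lean`), §2
  with `(α, β, S) = (π(·,0,0), π(0,·,0), T)` upgrades it to a `B₁`-fixed vector, and §2 again with
  `(α, β, S) = (π(0,·,0), π(·,0,0), -Tᵀ)` inside the closed subspace of `B₁`-fixed vectors gives `v₀`.

Consumer: `StoneVonNeumannUniqueness.lean` (the diagonal coefficient of `v₀` is forced ⇒ uniqueness of the irreducible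
unitary representation with central character `ψ`).  Nothing of [MoeglinVignerasWaldspurger1987] is asserted.

## References
* [MoeglinVignerasWaldspurger1987] C. Mœglin, M.-F. Vignéras, J.-L. Waldspurger, LNM 1291 (1987), Chap. 2 I.3 (`A^⊥`,
  self-dual lattices), I.6 (`S(ψ_A)` is a line), I.8 (Lemme: every smooth `ψ`-representation is a sum of copies of
  `ρ_ψ` — proof via `S'(ψ_A) ≠ 0`).
* [Weil1964] A. Weil, Acta Math. 111 (1964), Chap. I n° 11–12.
-/

set_option autoImplicit false

noncomputable section

open Matrix Set Filter Topology
open scoped NNReal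

namespace Literature.RepresentationTheory.HeisenbergGroup

open SchrodingerIrreducible

/-! ## §1 The Weyl form of the Heisenberg relations -/

section Weyl

variable {R : Type*} [CommRing R] {X Y : Type*} [AddCommGroup X] [Module R X] [AddCommGroup Y] [Module R Y]
  (β : X →ₗ[R] Y →ₗ[R] R)

/-- `(x,0,0)(x',0,0) = (x+x',0,0)`: `X × 0 × 0` is an additive copy of `X`. [cite: Weil1964, Chap. I n° 4] -/
theorem mk_inl_mul_mk_inl (x x' : X) :
    ((⟨(x, 0), 0⟩ : Heisenberg (polar β)) * ⟨(x', 0), 0⟩) = ⟨(x + x', 0), 0⟩ := by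
  apply Heisenberg.ext
  · simp only [Heisenberg.mul_v, Prod.mk_add_mk, add_zero]
  · simp only [Heisenberg.mul_t, polar_apply, map_zero, add_zero]

/-- `(0,y,0)(0,y',0) = (0,y+y',0)`. [cite: Weil1964, Chap. I n° 4] -/
theorem mk_inr_mul_mk_inr (y y' : Y) :
    ((⟨(0, y), 0⟩ : Heisenberg (polar β)) * ⟨(0, y'), 0⟩) = ⟨(0, y + y'), 0⟩ := by
  apply Heisenberg.ext
  · simp only [Heisenberg.mul_v, Prod.mk_add_mk, add_zero]
  · simp only [Heisenberg.mul_t, polar_apply, map_zero, LinearMap.zero_apply, add_zero]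

/-- **the Weyl commutation relation in the group**: `(x,0,0)(0,y,0) = (0,0,β x y) · (0,y,0)(x,0,0)`.
[cite: Weil1964, Chap. I n° 4] -/
theorem mk_inl_mul_mk_inr (x : X) (y : Y) :
    ((⟨(x, 0), 0⟩ : Heisenberg (polar β)) * ⟨(0, y), 0⟩) =
      Heisenberg.ofCenter (polar β) (Multiplicative.ofAdd (β x y)) * (⟨(0, y), 0⟩ * ⟨(x, 0), 0⟩) := by
  apply Heisenberg.ext
  · simp only [Heisenberg.mul_v, Heisenberg.ofCenter_v, Prod.mk_add_mk, add_zero, zero_add]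
  · simp only [Heisenberg.mul_t, Heisenberg.mul_v, Heisenberg.ofCenter_t, Heisenberg.ofCenter_v, polar_apply,
      toAdd_ofAdd, map_zero, LinearMap.zero_apply, add_zero, zero_add, Prod.mk_add_mk]

/-- every element factors as `(x,y,t) = (0,0,t - β x y) · (x,0,0)(0,y,0)`. [cite: Weil1964, Chap. I n° 4] -/
theorem mk_eq_ofCenter_mul (x : X) (y : Y) (t : R) :
    (⟨(x, y), t⟩ : Heisenberg (polar β)) =
      Heisenberg.ofCenter (polar β) (Multiplicative.ofAdd (t - β x y)) * (⟨(x, 0), 0⟩ * ⟨(0, y), 0⟩) := by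
  apply Heisenberg.ext
  · simp only [Heisenberg.mul_v, Heisenberg.ofCenter_v, Prod.mk_add_mk, add_zero, zero_add]
  · simp only [Heisenberg.mul_t, Heisenberg.mul_v, Heisenberg.ofCenter_t, Heisenberg.ofCenter_v, polar_apply,
      toAdd_ofAdd, map_zero, LinearMap.zero_apply, add_zero, zero_add, Prod.mk_add_mk, sub_add_cancel]

variable {E : Type*} [AddCommGroup E] [Module ℂ E] (π : Representation ℂ (Heisenberg (polar β)) E) (ψ : AddChar R Circle)

/-- **Weyl relation for the operators**: if the centre acts by `ψ`, then
`π(x,0,0) π(0,y,0) v = ψ(β x y) • π(0,y,0) π(x,0,0) v`. [cite: Weil1964, Chap. I n° 4] -/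
theorem apply_inl_apply_inr
    (hπz : ∀ (t : R) (v : E), π (Heisenberg.ofCenter (polar β) (Multiplicative.ofAdd t)) v = ((ψ t : Circle) : ℂ) • v)
    (x : X) (y : Y) (v : E) :
    π ⟨(x, 0), 0⟩ (π ⟨(0, y), 0⟩ v) = ((ψ (β x y) : Circle) : ℂ) • π ⟨(0, y), 0⟩ (π ⟨(x, 0), 0⟩ v) := by
  rw [← Module.End.mul_apply, ← map_mul, mk_inl_mul_mk_inr, map_mul, Module.End.mul_apply, hπz, map_mul,
    Module.End.mul_apply]

/-- the same relation read from the other side: `π(0,y,0) π(x,0,0) v = ψ(β x y)⁻¹ • π(x,0,0) π(0,y,0) v`.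
[cite: Weil1964, Chap. I n° 4] -/
theorem apply_inr_apply_inl
    (hπz : ∀ (t : R) (v : E), π (Heisenberg.ofCenter (polar β) (Multiplicative.ofAdd t)) v = ((ψ t : Circle) : ℂ) • v)
    (x : X) (y : Y) (v : E) :
    π ⟨(0, y), 0⟩ (π ⟨(x, 0), 0⟩ v) = ((ψ (-(β x y)) : Circle) : ℂ) • π ⟨(x, 0), 0⟩ (π ⟨(0, y), 0⟩ v) := by
  rw [apply_inl_apply_inr β π ψ hπz, smul_smul, AddChar.map_neg_eq_inv, Circle.coe_inv,
    inv_mul_cancel₀ (Circle.coe_ne_zero _), one_smul]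

/-- a general element acts by `π(x,y,t) = ψ(t - β x y) • π(x,0,0) π(0,y,0)`. [cite: Weil1964, Chap. I n° 4] -/
theorem apply_mk_eq
    (hπz : ∀ (t : R) (v : E), π (Heisenberg.ofCenter (polar β) (Multiplicative.ofAdd t)) v = ((ψ t : Circle) : ℂ) • v)
    (x : X) (y : Y) (t : R) (v : E) :
    π ⟨(x, y), t⟩ v = ((ψ (t - β x y) : Circle) : ℂ) • π ⟨(x, 0), 0⟩ (π ⟨(0, y), 0⟩ v) := by
  conv_lhs => rw [mk_eq_ofCenter_mul β x y t]
  rw [map_mul, Module.End.mul_apply, hπz, map_mul, Module.End.mul_apply]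

/-- `(0, 0, 0)` acts trivially. [cite: Weil1964, Chap. I n° 4] -/
theorem apply_mk_zero (v : E) : π ⟨((0 : X), (0 : Y)), 0⟩ v = v := by
  rw [show (⟨((0 : X), (0 : Y)), 0⟩ : Heisenberg (polar β)) = 1 from rfl, map_one, Module.End.one_apply]

end Weyl

section Averaging

variable {F : Type*} [NormedField F] {n : ℕ} (S : Matrix (Fin n) (Fin n) F) (ψ : AddChar F Circle)
  {E : Type*} [AddCommGroup E] [Module ℂ E]
  (α βop : Representation ℂ (Multiplicative (Fin n → F)) E)

/-! ## §2 The averaging step for an abstract Weyl pair `α_x β_y = ψ(x · S y) β_y α_x` -/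

/-- for `z` fixed by `α(A₀)`, `α_a z` only depends on the class of `a ∈ A` modulo `A₀`.
[cite: MoeglinVignerasWaldspurger1987, Chap. 2 I.8] -/
theorem apply_eq_of_mk_eq {A A₀ : AddSubgroup (Fin n → F)} {z : E}
    (hz : ∀ a ∈ A₀, α (Multiplicative.ofAdd a) z = z) {a b : A}
    (h : (QuotientAddGroup.mk a : A ⧸ A₀.addSubgroupOf A) = QuotientAddGroup.mk b) :
    α (Multiplicative.ofAdd (a : Fin n → F)) z = α (Multiplicative.ofAdd (b : Fin n → F)) z := by
  have hm : -(a : Fin n → F) + b ∈ A₀ := by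
    have := QuotientAddGroup.eq.mp h
    rwa [AddSubgroup.mem_addSubgroupOf, AddSubgroup.coe_add, AddSubgroup.coe_neg] at this
  have e : (b : Fin n → F) = a + (-(a : Fin n → F) + b) := by abel
  rw [e, ofAdd_add, map_mul, Module.End.mul_apply, hz _ hm]

/-- **averages over `A/A₀` are `A`-invariant**: for `z` fixed by `α(A₀)` and any section `s` of `A → A/A₀`,
`α_a (∑_q α_{s q} z) = ∑_q α_{s q} z` for `a ∈ A` (translation by `a` permutes the classes).
[cite: MoeglinVignerasWaldspurger1987, Chap. 2 I.8] -/
theorem apply_sum_out_eq {A A₀ : AddSubgroup (Fin n → F)} [Fintype (A ⧸ A₀.addSubgroupOf A)] {z : E}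
    (hz : ∀ a ∈ A₀, α (Multiplicative.ofAdd a) z = z) {a : Fin n → F} (ha : a ∈ A) :
    α (Multiplicative.ofAdd a) (∑ q : A ⧸ A₀.addSubgroupOf A, α (Multiplicative.ofAdd (q.out : Fin n → F)) z) =
      ∑ q : A ⧸ A₀.addSubgroupOf A, α (Multiplicative.ofAdd (q.out : Fin n → F)) z := by
  rw [map_sum]
  have step : ∀ q : A ⧸ A₀.addSubgroupOf A,
      α (Multiplicative.ofAdd a) (α (Multiplicative.ofAdd (q.out : Fin n → F)) z) =
        α (Multiplicative.ofAdd (((QuotientAddGroup.mk (⟨a, ha⟩ : A) + q).out : A) : Fin n → F)) z := by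
    intro q
    rw [← Module.End.mul_apply, ← map_mul, ← ofAdd_add]
    have e : a + (q.out : Fin n → F) = (((⟨a, ha⟩ : A) + q.out : A) : Fin n → F) := rfl
    rw [e]
    refine apply_eq_of_mk_eq α hz ?_
    rw [QuotientAddGroup.mk_add, QuotientAddGroup.out_eq', QuotientAddGroup.out_eq']
  simp_rw [step]
  exact Equiv.sum_comp (Equiv.addLeft (QuotientAddGroup.mk (⟨a, ha⟩ : A) : A ⧸ A₀.addSubgroupOf A))
    (fun q => α (Multiplicative.ofAdd ((q.out : A) : Fin n → F)) z)

/-- **the averaging step.**  `α`, `β` representations of the additive group `Fⁿ` on a complex vector space with the Weyl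
relation `α_x β_y = ψ(x · S y) β_y α_x`; `A₀ ≤ A` additive subgroups with `A` compact, `A₀` open, `A₀^⊥` compact, `A^⊥` open
(duals for `S`), and SEPARATION for `A₀` (`x ∉ A₀ ⇒ ψ(x · S y) ≠ 1` for some `y ∈ A₀^⊥`); `W` a subspace stable under
`α(A)` and `β(A₀^⊥)`.  If `u ∈ W`, `u ≠ 0`, is fixed by `α(A₀)`, then some NON-ZERO `w ∈ W` is fixed by all of `α(A)` —
namely one of the averages `∑_{q ∈ A/A₀} α_{s q} β_y u`, `y ∈ A₀^⊥`, which cannot all vanish by the finite Fourier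
inversion on `A₀^⊥ / A^⊥`. [cite: MoeglinVignerasWaldspurger1987, Chap. 2 I.8] -/
theorem exists_sum_fixed_ne_zero
    (hcomm : ∀ (x y : Fin n → F) (v : E), α (Multiplicative.ofAdd x) (βop (Multiplicative.ofAdd y) v) =
      ((ψ (x ⬝ᵥ S *ᵥ y) : Circle) : ℂ) • βop (Multiplicative.ofAdd y) (α (Multiplicative.ofAdd x) v))
    {A A₀ : AddSubgroup (Fin n → F)} (hA : IsCompact (A : Set (Fin n → F)))
    (hA₀ : IsOpen (A₀ : Set (Fin n → F))) (hK : IsCompact (charDual S ψ (A₀ : Set (Fin n → F)) : Set (Fin n → F)))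
    (hM : IsOpen (charDual S ψ (A : Set (Fin n → F)) : Set (Fin n → F)))
    (hsep : ∀ x : Fin n → F, x ∉ A₀ → ∃ y ∈ charDual S ψ (A₀ : Set (Fin n → F)), ψ (x ⬝ᵥ S *ᵥ y) ≠ 1)
    (W : Submodule ℂ E) (hWα : ∀ a ∈ A, ∀ w ∈ W, α (Multiplicative.ofAdd a) w ∈ W)
    (hWβ : ∀ y ∈ charDual S ψ (A₀ : Set (Fin n → F)), ∀ w ∈ W, βop (Multiplicative.ofAdd y) w ∈ W)
    {u : E} (huW : u ∈ W) (hu0 : u ≠ 0) (hu : ∀ a ∈ A₀, α (Multiplicative.ofAdd a) u = u) :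
    ∃ w ∈ W, w ≠ 0 ∧ ∀ a ∈ A, α (Multiplicative.ofAdd a) w = w := by
  classical
  -- the finite quotients `A / A₀` and `A₀^⊥ / A^⊥`
  haveI : Finite (A ⧸ A₀.addSubgroupOf A) := finite_quotient_of_isCompact_isOpen A A₀ hA hA₀
  haveI : Fintype (A ⧸ A₀.addSubgroupOf A) := Fintype.ofFinite _
  set K : AddSubgroup (Fin n → F) := charDual S ψ (A₀ : Set (Fin n → F)) with hKdef
  set M : AddSubgroup (Fin n → F) := charDual S ψ (A : Set (Fin n → F)) with hMdef
  haveI : Finite (K ⧸ M.addSubgroupOf K) := finite_quotient_of_isCompact_isOpen K M hK hM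
  haveI : Fintype (K ⧸ M.addSubgroupOf K) := Fintype.ofFinite _
  have hsA : ∀ q : A ⧸ A₀.addSubgroupOf A, ((q.out : A) : Fin n → F) ∈ A := fun q => (q.out : A).2
  -- (i) `β_y u` is `α(A₀)`-fixed for `y ∈ A₀^⊥`
  have hfix : ∀ y ∈ K, ∀ a ∈ A₀,
      α (Multiplicative.ofAdd a) (βop (Multiplicative.ofAdd y) u) = βop (Multiplicative.ofAdd y) u := by
    intro y hy a ha
    rw [hcomm, hu a ha, hy a ha, Circle.coe_one, one_smul]
  -- (ii) the averages `w_y = ∑_q α_{s q} β_y u` are `α(A)`-fixed and lie in `W`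
  have hwfix : ∀ y ∈ K, ∀ a ∈ A,
      α (Multiplicative.ofAdd a) (∑ q : A ⧸ A₀.addSubgroupOf A,
        α (Multiplicative.ofAdd ((q.out : A) : Fin n → F)) (βop (Multiplicative.ofAdd y) u)) =
      ∑ q : A ⧸ A₀.addSubgroupOf A,
        α (Multiplicative.ofAdd ((q.out : A) : Fin n → F)) (βop (Multiplicative.ofAdd y) u) :=
    fun y hy a ha => apply_sum_out_eq α (hfix y hy) ha
  have hwW : ∀ y ∈ K, (∑ q : A ⧸ A₀.addSubgroupOf A,
      α (Multiplicative.ofAdd ((q.out : A) : Fin n → F)) (βop (Multiplicative.ofAdd y) u)) ∈ W :=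
    fun y hy => W.sum_mem fun q _ => hWα _ (hsA q) _ (hWβ y hy u huW)
  -- (iii) they do not all vanish
  suffices hex : ∃ y ∈ K, (∑ q : A ⧸ A₀.addSubgroupOf A,
      α (Multiplicative.ofAdd ((q.out : A) : Fin n → F)) (βop (Multiplicative.ofAdd y) u)) ≠ 0 by
    obtain ⟨y, hy, hne⟩ := hex
    exact ⟨_, hwW y hy, hne, hwfix y hy⟩
  by_contra hall
  push Not at hall
  -- applying `β_{-y}`: the twisted sums `∑_q ψ(s q · S y) α_{s q} u` vanish for `y ∈ A₀^⊥`
  have hvan : ∀ y ∈ K, ∑ q : A ⧸ A₀.addSubgroupOf A,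
      ((ψ (((q.out : A) : Fin n → F) ⬝ᵥ S *ᵥ y) : Circle) : ℂ) •
        α (Multiplicative.ofAdd ((q.out : A) : Fin n → F)) u = 0 := by
    intro y hy
    have h1 : βop (Multiplicative.ofAdd y) (∑ q : A ⧸ A₀.addSubgroupOf A,
        ((ψ (((q.out : A) : Fin n → F) ⬝ᵥ S *ᵥ y) : Circle) : ℂ) •
          α (Multiplicative.ofAdd ((q.out : A) : Fin n → F)) u) = 0 := by
      rw [← hall y hy, map_sum]
      refine Finset.sum_congr rfl fun q _ => ?_
      rw [map_smul, hcomm]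
    have h2 := congrArg (βop (Multiplicative.ofAdd (-y))) h1
    rwa [map_zero, ← Module.End.mul_apply, ← map_mul, ← ofAdd_add, neg_add_cancel, ofAdd_zero, map_one,
      Module.End.one_apply] at h2
  -- the characters `k ↦ ψ(s q · S k)` of `A₀^⊥ / A^⊥` are pairwise distinct (separation for `A₀`)
  have hsM : ∀ q : A ⧸ A₀.addSubgroupOf A, ∀ m ∈ M, ψ (((q.out : A) : Fin n → F) ⬝ᵥ S *ᵥ m) = 1 :=
    fun q m hm => hm _ (hsA q)
  have hθ : Function.Injective fun q : A ⧸ A₀.addSubgroupOf A =>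
      quotChar S ψ K M ((q.out : A) : Fin n → F) (hsM q) := by
    intro q q' hqq'
    have h1 : ∀ k ∈ K, ψ ((((q.out : A) : Fin n → F) - ((q'.out : A) : Fin n → F)) ⬝ᵥ S *ᵥ k) = 1 :=
      fun k hk => apply_sub_eq_one_of_quotChar_eq S ψ K M (hsM q) (hsM q') hqq' hk
    have h2 : ((q.out : A) : Fin n → F) - ((q'.out : A) : Fin n → F) ∈ A₀ := by
      by_contra hn
      obtain ⟨y, hy, hne⟩ := hsep _ hn
      exact hne (h1 y hy)
    rw [← QuotientAddGroup.out_eq' q, ← QuotientAddGroup.out_eq' q']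
    refine QuotientAddGroup.eq.mpr ?_
    rw [AddSubgroup.mem_addSubgroupOf, AddSubgroup.coe_add, AddSubgroup.coe_neg]
    have h3 := A₀.neg_mem h2
    rwa [neg_sub, sub_eq_neg_add] at h3
  -- finite Fourier inversion: `α_{s q} u = 0`, contradicting `u ≠ 0`
  have hz : ∀ a' : K ⧸ M.addSubgroupOf K, ∑ q : A ⧸ A₀.addSubgroupOf A,
      quotChar S ψ K M ((q.out : A) : Fin n → F) (hsM q) a' •
        α (Multiplicative.ofAdd ((q.out : A) : Fin n → F)) u = 0 := by
    intro a'
    induction a' using QuotientAddGroup.induction_on with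
    | H k => simpa only [quotChar_mk] using hvan k k.2
  have h0 := eq_zero_of_forall_sum_smul_eq_zero _ hθ _ hz (QuotientAddGroup.mk (0 : A))
  apply hu0
  have h4 := congrArg (α (Multiplicative.ofAdd
    (-(((QuotientAddGroup.mk (0 : A) : A ⧸ A₀.addSubgroupOf A).out : A) : Fin n → F)))) h0
  rwa [map_zero, ← Module.End.mul_apply, ← map_mul, ← ofAdd_add, neg_add_cancel, ofAdd_zero, map_one,
    Module.End.one_apply] at h4

end Averaging

/-! ## §3 Lattice-fixed vectors in unitary `ψ`-representations -/

section Unitary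

variable {F : Type*} [NormedField F] [IsUltrametricDist F] [ProperSpace F] {n : ℕ}
  (T : Matrix (Fin n) (Fin n) F) (ψ : AddChar F Circle)
  {E : Type*} [NormedAddCommGroup E] [InnerProductSpace ℂ E] [CompleteSpace E]
  (π : Representation ℂ (Heisenberg (polar (Matrix.toLinearMap₂' F T))) E)

omit [IsUltrametricDist F] [ProperSpace F] [InnerProductSpace ℂ E] [CompleteSpace E] in
/-- strong continuity at the origin, quantitatively: a continuous orbit map `f` with `f 0 = v ≠ 0` stays within `‖v‖ / 2`
of `v` on a closed ball of positive radius `≤ 1`. [cite: MoeglinVignerasWaldspurger1987, Chap. 2 I.8] -/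
theorem exists_radius_norm_sub_le {f : (Fin n → F) → E} (hf : Continuous f) {v : E} (hf0 : f 0 = v) (hv : v ≠ 0) :
    ∃ r : ℝ, 0 < r ∧ r ≤ 1 ∧ ∀ x : Fin n → F, ‖x‖ ≤ r → ‖f x - v‖ ≤ ‖v‖ / 2 := by
  have hε : 0 < ‖v‖ / 2 := half_pos (norm_pos_iff.2 hv)
  obtain ⟨δ, hδ, hδε⟩ := Metric.continuousAt_iff.1 hf.continuousAt (‖v‖ / 2) hε
  refine ⟨min (δ / 2) 1, lt_min (half_pos hδ) one_pos, min_le_right _ _, fun x hx => ?_⟩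
  have hxδ : dist x 0 < δ := by
    rw [dist_zero_right]
    exact (hx.trans (min_le_left _ _)).trans_lt (half_lt_self hδ)
  have h := hδε hxδ
  rw [hf0, dist_eq_norm] at h
  exact h.le

/-- **existence of lattice-fixed vectors.**  `T ∈ GL_n(F)`, `ψ` continuous and non-trivial; `π` a representation of
`Heisenberg (polar β_T)` on a complex Hilbert space `E ≠ 0` by linear isometries, with continuous orbit maps
`w ↦ π(w, 0) v` and central character `ψ`.  Then some `v₀ ≠ 0` satisfies `π(x,0,0) v₀ = v₀` for all `x` in the unit ball
`B₁` and `π(0,y,0) v₀ = v₀` for all `y ∈ B₁^⊥` (`charDual T ψ B₁`) — the unitary form of "`S'(ψ_A) ≠ 0`" for the self-dual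
lattice `A = B₁ × B₁^⊥` of `W = Fⁿ ⊕ Fⁿ`. [cite: MoeglinVignerasWaldspurger1987, Chap. 2 I.8] -/
theorem exists_latticeFixed_ne_zero [Nontrivial E] (hT : IsUnit T.det) (hψc : Continuous ψ) (hψ1 : ∃ t, ψ t ≠ 1)
    (hπu : ∀ (h : Heisenberg (polar (Matrix.toLinearMap₂' F T))) (v : E), ‖π h v‖ = ‖v‖)
    (hπc : ∀ v : E, Continuous fun w : (Fin n → F) × (Fin n → F) => π ⟨w, 0⟩ v)
    (hπz : ∀ (t : F) (v : E), π (Heisenberg.ofCenter (polar (Matrix.toLinearMap₂' F T)) (Multiplicative.ofAdd t)) v =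
      ((ψ t : Circle) : ℂ) • v) :
    ∃ v₀ : E, v₀ ≠ 0 ∧ (∀ x ∈ Metric.closedBall (0 : Fin n → F) 1, π ⟨(x, 0), 0⟩ v₀ = v₀) ∧
      ∀ y ∈ charDual T ψ (Metric.closedBall (0 : Fin n → F) 1), π ⟨(0, y), 0⟩ v₀ = v₀ := by
  classical
  -- the two abelian halves as representations of `Multiplicative Fⁿ`
  let τ : Representation ℂ (Multiplicative (Fin n → F)) E :=
    { toFun := fun x => π ⟨(Multiplicative.toAdd x, 0), 0⟩
      map_one' := by rw [toAdd_one]; exact map_one π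
      map_mul' := fun a b => by rw [toAdd_mul, ← map_mul, mk_inl_mul_mk_inl] }
  let μ : Representation ℂ (Multiplicative (Fin n → F)) E :=
    { toFun := fun y => π ⟨(0, Multiplicative.toAdd y), 0⟩
      map_one' := by rw [toAdd_one]; exact map_one π
      map_mul' := fun a b => by rw [toAdd_mul, ← map_mul, mk_inr_mul_mk_inr] }
  have hτ : ∀ x v, τ (Multiplicative.ofAdd x) v = π ⟨(x, 0), 0⟩ v := fun x v => rfl
  have hμ : ∀ y v, μ (Multiplicative.ofAdd y) v = π ⟨(0, y), 0⟩ v := fun y v => rfl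
  have hτu : ∀ g v, ‖τ g v‖ = ‖v‖ := fun g v => hπu _ v
  have hμu : ∀ g v, ‖μ g v‖ = ‖v‖ := fun g v => hπu _ v
  -- the Weyl relations for `(τ, μ, T)` and `(μ, τ, -Tᵀ)`
  have hcomm : ∀ (x y : Fin n → F) (v : E), τ (Multiplicative.ofAdd x) (μ (Multiplicative.ofAdd y) v) =
      ((ψ (x ⬝ᵥ T *ᵥ y) : Circle) : ℂ) • μ (Multiplicative.ofAdd y) (τ (Multiplicative.ofAdd x) v) := by
    intro x y v
    rw [hτ, hμ, hτ, hμ, apply_inl_apply_inr _ π ψ hπz, Matrix.toLinearMap₂'_apply']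
  have hcomm' : ∀ (y x : Fin n → F) (v : E), μ (Multiplicative.ofAdd y) (τ (Multiplicative.ofAdd x) v) =
      ((ψ (y ⬝ᵥ (-Tᵀ) *ᵥ x) : Circle) : ℂ) • τ (Multiplicative.ofAdd x) (μ (Multiplicative.ofAdd y) v) := by
    intro y x v
    rw [hτ, hμ, hτ, hμ, apply_inr_apply_inl _ π ψ hπz, Matrix.toLinearMap₂'_apply', neg_mulVec, dotProduct_neg,
      ← dotProduct_mulVec_comm]
  -- the unit ball `B₁` and its dual
  set L : AddSubgroup (Fin n → F) :=
    (IsUltrametricDist.closedBall_openAddSubgroup (Fin n → F) one_pos).toAddSubgroup with hLdef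
  have hLcoe : (L : Set (Fin n → F)) = Metric.closedBall 0 1 := rfl
  have hLc : IsCompact (L : Set (Fin n → F)) := by rw [hLcoe]; exact isCompact_closedBall _ _
  have hLo : IsOpen (L : Set (Fin n → F)) := by rw [hLcoe]; exact IsUltrametricDist.isOpen_closedBall _ one_ne_zero
  have hLdual_c : IsCompact (charDual T ψ (L : Set (Fin n → F)) : Set (Fin n → F)) := by
    rw [hLcoe]; exact isCompact_charDual_closedBall T ψ hψc hT hψ1 one_pos
  have hLdual_o : IsOpen (charDual T ψ (L : Set (Fin n → F)) : Set (Fin n → F)) := by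
    rw [hLcoe]; exact isOpen_charDual T ψ hψc one_pos subset_rfl
  -- Step 0: a vector fixed by the translations of a small ball `B_{r₀}`
  obtain ⟨v, hv⟩ := exists_ne (0 : E)
  have hcont₁ : Continuous fun x : Fin n → F => π ⟨(x, 0), 0⟩ v :=
    (hπc v).comp (continuous_id.prodMk continuous_const)
  obtain ⟨r₀, hr₀, hr₀1, hr₀v⟩ := exists_radius_norm_sub_le hcont₁ (apply_mk_zero _ π v) hv
  set L₀ : AddSubgroup (Fin n → F) :=
    (IsUltrametricDist.closedBall_openAddSubgroup (Fin n → F) hr₀).toAddSubgroup with hL₀def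
  have hL₀coe : (L₀ : Set (Fin n → F)) = Metric.closedBall 0 r₀ := rfl
  obtain ⟨u, -, hu0, hu⟩ := Unitary.exists_fixed_ne_zero_of_forall_norm_sub_lt τ hτu (AddSubgroup.toSubgroup L₀) ⊤
    isClosed_univ (fun _ _ _ _ => Submodule.mem_top) (Submodule.mem_top : v ∈ (⊤ : Submodule ℂ E))
    (half_lt_self (norm_pos_iff.2 hv)) (fun g hg => by
      rw [Multiplicative.mem_toSubgroup] at hg
      have h := hr₀v (Multiplicative.toAdd g) (_root_.mem_closedBall_zero_iff.1 hg)
      exact h)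
  have hu' : ∀ a ∈ L₀, τ (Multiplicative.ofAdd a) u = u := fun a ha =>
    hu (Multiplicative.ofAdd a) (by rw [Multiplicative.mem_toSubgroup]; exact ha)
  -- Step 1: the averaging step for `(τ, μ, T)`, `A₀ = B_{r₀} ≤ A = B₁`, `W = ⊤`
  obtain ⟨w₁, -, hw₁0, hw₁⟩ := exists_sum_fixed_ne_zero T ψ τ μ hcomm (A := L) (A₀ := L₀) hLc
    (by rw [hL₀coe]; exact IsUltrametricDist.isOpen_closedBall _ hr₀.ne')
    (by rw [hL₀coe]; exact isCompact_charDual_closedBall T ψ hψc hT hψ1 hr₀) hLdual_o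
    (fun x hx => exists_mem_charDual_apply_ne_one T ψ hψc hT hψ1 hr₀
      (not_le.1 fun h => hx (_root_.mem_closedBall_zero_iff.2 h)))
    ⊤ (fun _ _ _ _ => Submodule.mem_top) (fun _ _ _ _ => Submodule.mem_top) Submodule.mem_top hu0 hu'
  -- the closed subspace `W` of `B₁`-fixed vectors
  set W : Submodule ℂ E := ⨅ x ∈ (L : Set (Fin n → F)), LinearMap.ker (π ⟨(x, 0), 0⟩ - 1) with hWdef
  have hmemW : ∀ w : E, w ∈ W ↔ ∀ x ∈ L, π ⟨(x, 0), 0⟩ w = w := by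
    intro w
    simp only [hWdef, Submodule.mem_iInf, LinearMap.mem_ker, LinearMap.sub_apply, Module.End.one_apply, sub_eq_zero,
      SetLike.mem_coe]
  have hWc : IsClosed (W : Set E) := by
    have e : (W : Set E) = ⋂ x ∈ (L : Set (Fin n → F)), {w : E | π ⟨(x, 0), 0⟩ w = w} := by
      ext w
      simp only [SetLike.mem_coe, hmemW, Set.mem_iInter, Set.mem_setOf_eq]
    rw [e]
    exact isClosed_biInter fun x _ => isClosed_eq
      (AddMonoidHomClass.continuous_of_bound (π ⟨(x, 0), 0⟩) 1 fun w => by rw [hπu, one_mul]) continuous_id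
  have hw₁W : w₁ ∈ W := (hmemW w₁).2 hw₁
  -- `μ_y` preserves `W` for `y ∈ B₁^⊥`; `τ_x` preserves `W` for every `x`
  have hWμ : ∀ y ∈ charDual T ψ (L : Set (Fin n → F)), ∀ w ∈ W, μ (Multiplicative.ofAdd y) w ∈ W := by
    intro y hy w hw
    rw [hmemW] at hw ⊢
    intro x hx
    rw [← hτ, hcomm, hτ, hw x hx, hy x hx, Circle.coe_one, one_smul]
  have hWτ : ∀ (x : Fin n → F), ∀ w ∈ W, τ (Multiplicative.ofAdd x) w ∈ W := by
    intro x w hw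
    rw [hmemW] at hw ⊢
    intro x' hx'
    rw [← hτ x', ← Module.End.mul_apply, ← map_mul, ← ofAdd_add, add_comm, ofAdd_add, map_mul, Module.End.mul_apply,
      hτ x', hw x' hx']
  -- Step 2a: inside `W`, a vector fixed by the modulations of a small ball `B_{r₁} ⊆ B₁^⊥`
  have hcont₂ : Continuous fun y : Fin n → F => π ⟨(0, y), 0⟩ w₁ :=
    (hπc w₁).comp (continuous_const.prodMk continuous_id)
  obtain ⟨r₂, hr₂, -, hr₂v⟩ := exists_radius_norm_sub_le hcont₂ (apply_mk_zero _ π w₁) hw₁0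
  obtain ⟨ε, hε, hεsub⟩ := Metric.mem_nhds_iff.1 (charDual_mem_nhds_zero T ψ hψc one_pos (subset_refl (Metric.closedBall 0 1)))
  set r₁ : ℝ := min r₂ (ε / 2) with hr₁def
  have hr₁ : 0 < r₁ := lt_min hr₂ (half_pos hε)
  set M₁ : AddSubgroup (Fin n → F) :=
    (IsUltrametricDist.closedBall_openAddSubgroup (Fin n → F) hr₁).toAddSubgroup with hM₁def
  have hM₁coe : (M₁ : Set (Fin n → F)) = Metric.closedBall 0 r₁ := rfl
  have hM₁le : ∀ y ∈ M₁, y ∈ charDual T ψ (L : Set (Fin n → F)) := by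
    intro y hy
    refine hεsub (_root_.mem_ball_zero_iff.2 ?_)
    exact ((_root_.mem_closedBall_zero_iff.1 hy).trans (min_le_right _ _)).trans_lt (half_lt_self hε)
  obtain ⟨u₂, hu₂W, hu₂0, hu₂⟩ := Unitary.exists_fixed_ne_zero_of_forall_norm_sub_lt μ hμu (AddSubgroup.toSubgroup M₁) W
    hWc (fun g hg w hw => hWμ _ (hM₁le _ ((Multiplicative.mem_toSubgroup _ _).1 hg)) w hw) hw₁W
    (half_lt_self (norm_pos_iff.2 hw₁0)) (fun g hg => by
      rw [Multiplicative.mem_toSubgroup] at hg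
      exact hr₂v (Multiplicative.toAdd g) ((_root_.mem_closedBall_zero_iff.1 hg).trans (min_le_left _ _)))
  have hu₂' : ∀ a ∈ M₁, μ (Multiplicative.ofAdd a) u₂ = u₂ := fun a ha =>
    hu₂ (Multiplicative.ofAdd a) (by rw [Multiplicative.mem_toSubgroup]; exact ha)
  -- Step 2b: the averaging step for `(μ, τ, -Tᵀ)`, `A₀ = B_{r₁} ≤ A = B₁^⊥`, inside `W`
  have hTt : IsUnit (-Tᵀ).det := by
    rw [det_neg, det_transpose]
    exact ((isUnit_one.neg).pow _).mul hT
  obtain ⟨R, hR⟩ := (hLdual_c.isBounded).subset_closedBall (0 : Fin n → F)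
  have hRpos : 0 < max R 1 := lt_of_lt_of_le one_pos (le_max_right _ _)
  have hAsub : (charDual T ψ (L : Set (Fin n → F)) : Set (Fin n → F)) ⊆ Metric.closedBall 0 (max R 1) :=
    hR.trans (Metric.closedBall_subset_closedBall (le_max_left _ _))
  obtain ⟨v₀, hv₀W, hv₀0, hv₀⟩ := exists_sum_fixed_ne_zero (-Tᵀ) ψ μ τ hcomm'
    (A := charDual T ψ (L : Set (Fin n → F))) (A₀ := M₁) hLdual_c
    (by rw [hM₁coe]; exact IsUltrametricDist.isOpen_closedBall _ hr₁.ne')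
    (by rw [hM₁coe]; exact isCompact_charDual_closedBall (-Tᵀ) ψ hψc hTt hψ1 hr₁)
    (isOpen_charDual (-Tᵀ) ψ hψc hRpos hAsub)
    (fun x hx => exists_mem_charDual_apply_ne_one (-Tᵀ) ψ hψc hTt hψ1 hr₁
      (not_le.1 fun h => hx (_root_.mem_closedBall_zero_iff.2 h)))
    W (fun a ha w hw => hWμ a ha w hw) (fun x _ w hw => hWτ x w hw) hu₂W hu₂0 hu₂'
  refine ⟨v₀, hv₀0, fun x hx => ?_, fun y hy => ?_⟩
  · exact ((hmemW v₀).1 hv₀W) x hx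
  · rw [← hμ]
    exact hv₀ y hy

end Unitary

end Literature.RepresentationTheory.HeisenbergGroup

end
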